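import Summits.Schanuel.Schanuel.Theorems.DiophantineDichotomyApproximationPropertySliceOne
import Summits.Schanuel.Schanuel.Theorems.DiophantineDichotomyApproximationPropertyTernaryBox
import Summits.Schanuel.Schanuel.Theorems.DiophantineDichotomyApproximationPropertySmallPrimeCurve
import Summits.Schanuel.Schanuel.Theorems.DiophantineDichotomyApproximationPropertyBoxModCurve
import Summits.Schanuel.Schanuel.Theorems.DiophantineDichotomyApproximationPropertyCIDecomposition
import Summits.Schanuel.Schanuel.Theorems.DiophantineDichotomyApproximationPropertyCIInterpolation
import Summits.Schanuel.Schanuel.Theorems.DiophantineDichotomyApproximationPropertySliceTwo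
import Summits.Schanuel.Schanuel.Theorems.DiophantineDichotomyApproximationPropertyCycleAPIAt3Data
import Summits.Schanuel.Schanuel.Theorems.DiophantineDichotomyApproximationPropertyCycleAPIAt3SatelliteDichotomy
import Summits.Schanuel.Schanuel.Theorems.DiophantineDichotomyApproximationPropertyCycleAPIAt3SatelliteHeightLine
import Summits.Schanuel.Schanuel.Theorems.DiophantineDichotomyApproximationPropertyCycleAPIAt3ContainerRestart
import Summits.Schanuel.Schanuel.Theorems.DiophantineDichotomyApproximationPropertyPointDatumOfLineSatellite
import Summits.Schanuel.Schanuel.Theorems.DiophantineDichotomyApproximationPropertyPointDatumOfLineSatelliteLog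
import Summits.Schanuel.Schanuel.Theorems.DiophantineDichotomyApproximationPropertyPointDatumOfBoundedSatellite
import Summits.Schanuel.Schanuel.Theorems.DiophantineDichotomyApproximationPropertyCycleAPIAt3OrbitFloorLog
import Summits.Schanuel.Schanuel.Theorems.DiophantineDichotomyApproximationPropertyCycleAPIAt3SatelliteHeight

import HarnessLib

/-!
# `PointAPAbsAt 3` and the `t = 3` slice of the crux, CONDITIONALLY on the two `t = 3` residuals (crux `ApproximationProperty`, stmt-Schanuel-6117)

Crux `stmt-Schanuel-6117` (`Summit.Schanuel.Schanuel.Theses.DiophantineDichotomy.ApproximationProperty`),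
route `DiophantineDichotomy`, line `orbit-interpolation-determinant`, lead c5
(`prover-line-stmt-Schanuel-6117-c5-0`, skeleton v13 `Cruxes/ApproximationProperty/Lines/orbit_interpolation_determinant.lean`).

This file LANDS, as real theorems with explicit hypotheses (no `sorry`, no new definition, no named
fact), the kernel-checked `t = 3` content of skeleton v13: Philippon's point approximation property
`PointAPAbsAt 3` — hence the approximation property for every `θ ∈ ℂ^ι` with `trdeg_ℚ ℚ(θ) ≤ 3`
(`PointwiseAPSlice 3`, not in print) — follows from exactly TWO statements, both taken as hypotheses:
* `IsolatedPointClause3` (…CycleAPIAt3Defs.lean): isolated Galois orbits of three forms of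
  `ℚ[x₀, …, x₃]` impose independent conditions from degree `3δ₀ − 2` on — the dimension-`0` case of
  Chardin–Philippon's regularity theorem (J. Algebraic Geom. 8 (1999) 471–481, erratum 11 (2002)
  599–600; texts requested, acq-06248 / acq-06484);
* the FAR-SATELLITE DATUM beyond a threshold (registered stub `pointDatum_of_farSatellite3_beyond` of
  the skeleton, spelled out verbatim as the hypothesis `hfarStub`): for a long orbit of the clause-free
  `t = 3` descent failing the interpolation clause and lying on a satellite of degree `> δ⋆` of the
  cut-2 complete intersection, a point datum still exists — the open kernel (≈ Philippon's AP2 at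
  `n = 3` for such orbits; implied by `PointAPAbsAt 3` itself, so a necessary hypothesis too).
Everything else is in the tree: the clause-free descent with its data (`stub_cycleAP3Data`, p125258),
the good-orbit transfer (`pointDatum_of_clause`, p121904), the satellite dichotomy (p120163), the
orbit floor in log form (`orbitFloorLog`, p128440 / p128869 + p127900), the line-satellite branch
(`pointDatum_of_lineSatellite3_log`, p127736), the satellite height (`stub_satelliteHeight`, p129211)
and the bounded-degree satellite branch (`pointDatum_of_boundedSatellite3`, p128115), the container
restart (p125560), `CycleAPIAt 1, 2`, the dictionary, the lever, the sharp closest point, `stub_pointAP`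
and the lifting `stub_lift`.

Main results: `pointDatum_of_datum3_of`, `pointAPAt3_of`, `slice_three_of_isolatedClause_of_farBeyond`
(registered sub-goal of the crux item). Bookkeeping lemmas `PointAPThreeConditional.datum_mono`,
`PointAPThreeConditional.orbitBounds_mono`.

Sources: NesterenkoPhilippon2001 (LNM 1752) Ch. 3 §4, Ch. 4 §4 p. 61 (AP1 ⇒ AP2 scheme, AP2 proved
for `n ≤ 2` only); Philippon2000; ChardinPhilippon1999; LaurentRoy1999.
-/

set_option linter.dupNamespace false

namespace Summit.Schanuel.Schanuel.Cruxes.ApproximationProperty.OrbitInterpolationDeterminant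

open Summit.Schanuel.Schanuel.Theses.DiophantineDichotomy
open Literature.NumberTheory.Transcendental.Nesterenko MvPolynomial
open scoped BigOperators

attribute [local instance] MvPolynomial.gradedAlgebra

noncomputable section

namespace PointAPThreeConditional

/-- A point datum at the scale `(Δ, Y')` with `Y ≤ Y'` and constant `c'` is a datum at `(Δ, Y)` with any
constant `c ≥ c'` such that `c' Y' ≤ c Y` (monotonicity of the three budgets). [folklore] -/
theorem datum_mono {ω : Fin 3 → ℂ} {c c' Δ Y Y' : ℝ} (hc' : 1 ≤ c') (hcc : c' ≤ c) (hΔ : 0 ≤ Δ)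
    (hY : 0 ≤ Y) (hYY : Y ≤ Y') (hbud : c' * Y' ≤ c * Y)
    (h : ∃ (K : Type) (_ : Field K) (_ : NumberField K) (β : Fin 3 → K) (σ : K →+* ℂ),
      (Module.finrank ℚ K : ℝ) ≤ (c' * Δ) ^ 3 ∧
      Height.logHeight (Fin.cons (1 : K) β : Fin (3 + 1) → K) ≤ c' * Y' * Δ ^ 2 ∧
      ‖(fun j => σ (β j)) - ω‖ ≤
        Real.exp (-((Δ * Height.logHeight (Fin.cons (1 : K) β : Fin (3 + 1) → K) +
          Y' * Module.finrank ℚ K) / c'))) :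
    ∃ (K : Type) (_ : Field K) (_ : NumberField K) (β : Fin 3 → K) (σ : K →+* ℂ),
      (Module.finrank ℚ K : ℝ) ≤ (c * Δ) ^ 3 ∧
      Height.logHeight (Fin.cons (1 : K) β : Fin (3 + 1) → K) ≤ c * Y * Δ ^ 2 ∧
      ‖(fun j => σ (β j)) - ω‖ ≤
        Real.exp (-((Δ * Height.logHeight (Fin.cons (1 : K) β : Fin (3 + 1) → K) +
          Y * Module.finrank ℚ K) / c)) := by
  obtain ⟨K, iF, iN, β, σ, h1, h2, h3⟩ := h
  have hc'0 : 0 < c' := lt_of_lt_of_le one_pos hc'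
  have hc0 : 0 < c := lt_of_lt_of_le hc'0 hcc
  have hh0 : 0 ≤ Height.logHeight (Fin.cons (1 : K) β : Fin (3 + 1) → K) := Height.logHeight_nonneg _
  have hD0 : 0 ≤ (Module.finrank ℚ K : ℝ) := Nat.cast_nonneg _
  refine ⟨K, iF, iN, β, σ, ?_, ?_, ?_⟩
  · exact h1.trans (pow_le_pow_left₀ (by positivity) (mul_le_mul_of_nonneg_right hcc hΔ) 3)
  · calc Height.logHeight (Fin.cons (1 : K) β : Fin (3 + 1) → K) ≤ c' * Y' * Δ ^ 2 := h2
      _ ≤ c * Y * Δ ^ 2 := mul_le_mul_of_nonneg_right hbud (by positivity)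
  · refine h3.trans (Real.exp_le_exp.mpr ?_)
    rw [neg_le_neg_iff]
    set h := Height.logHeight (Fin.cons (1 : K) β : Fin (3 + 1) → K)
    set D := (Module.finrank ℚ K : ℝ)
    have e1 : (Δ * h + Y * D) / c ≤ (Δ * h + Y * D) / c' :=
      div_le_div_of_nonneg_left (by positivity) hc'0 hcc
    have e2 : (Δ * h + Y * D) / c' ≤ (Δ * h + Y' * D) / c' :=
      div_le_div_of_nonneg_right (by nlinarith) hc'0.le
    exact e1.trans e2

/-- The bounds of a prime orbit in the AP1 currency are monotone in the constant: `(c₁Δ)³ ≤ (c₂Δ)³`,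
`c₁λYΔ² ≤ c₂λYΔ²`, `exp(−S/c₁) ≤ exp(−S/c₂)` for `1 ≤ c₁ ≤ c₂` (`S ≥ 0`). [folklore] -/
theorem orbitBounds_mono {ω : Fin 3 → ℂ} {𝔭 : Ideal (Rx 3)} {c₁ c₂ Δ Y : ℝ} (hc₁ : 1 ≤ c₁)
    (hc : c₁ ≤ c₂) (hΔ : 0 ≤ Δ) (hY : 0 ≤ Y)
    (hdeg : (ideg 𝔭 1 : ℝ) ≤ (c₁ * Δ) ^ 3) (hht : iheight 𝔭 1 ≤ c₁ * Y * Δ ^ 2)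
    (habs : iabs 𝔭 1 (Fin.cons 1 ω) ≤ Real.exp (-((Δ * iheight 𝔭 1 + Y * ideg 𝔭 1) / c₁))) :
    (ideg 𝔭 1 : ℝ) ≤ (c₂ * Δ) ^ 3 ∧ iheight 𝔭 1 ≤ c₂ * Y * Δ ^ 2 ∧
      iabs 𝔭 1 (Fin.cons 1 ω) ≤ Real.exp (-((Δ * iheight 𝔭 1 + Y * ideg 𝔭 1) / c₂)) := by
  have hc₁0 : 0 < c₁ := by linarith
  have hh0 : 0 ≤ iheight 𝔭 1 := height_nonneg _
  have hD0 : 0 ≤ (ideg 𝔭 1 : ℝ) := Nat.cast_nonneg _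
  refine ⟨hdeg.trans (pow_le_pow_left₀ (by positivity) (mul_le_mul_of_nonneg_right hc hΔ) 3),
    hht.trans (mul_le_mul_of_nonneg_right (mul_le_mul_of_nonneg_right hc hY) (by positivity)), ?_⟩
  refine habs.trans (Real.exp_le_exp.mpr ?_)
  rw [neg_le_neg_iff]
  exact div_le_div_of_nonneg_left (by positivity) hc₁0 hc

end PointAPThreeConditional

open PointAPThreeConditional in
/-- **The point datum from ANY datum of the clause-free descent, conditionally** on
`IsolatedPointClause3` (Chardin–Philippon, dim 0) and on the far-satellite datum beyond a threshold
(the skeleton's open stub, verbatim as `hfarStub`). Case tree: (G) clause ⇒ `pointDatum_of_clause`;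
(I) isolated ⇒ `hCP` ⇒ (G); (L) line satellite ⇒ `pointDatum_of_lineSatellite3_log`; (B) satellite of
degree `≤ δ⋆` ⇒ `pointDatum_of_boundedSatellite3`; (F) degree `> δ⋆` ⇒ `hfarStub` (consulted first: it
fixes `δ⋆`). [cite: NesterenkoPhilippon2001, Ch. 4 §4 p. 61 (AP1 ⇒ AP2 scheme)] -/
theorem pointDatum_of_datum3_of (hCP : IsolatedPointClause3)
    (hfarStub : ∀ (ω : Fin 3 → ℂ) (c₁ : ℝ), 1 ≤ c₁ → ∃ δstar : ℕ, 1 ≤ δstar ∧ ∃ lam : ℝ, 1 ≤ lam ∧ ∃ c : ℝ, c₁ ≤ c ∧ ∀ Δ Y : ℝ, c ≤ Δ → Δ ≤ Y → ∀ (Q : Rx 3) (a : ℕ) (P : Rx 3) (b : ℕ) (𝔮 : Ideal (Rx 3)) (T : Rx 3) (τ : ℕ) (𝔭 𝔮' : Ideal (Rx 3)), CycleAP3Datum ω c₁ Δ (lam * Y) Q a P b 𝔮 T τ 𝔭 → 𝔮'.IsPrime → 𝔮'.IsHomogeneous (homogeneousSubmodule (Fin (3 + 1)) ℚ) → IsUnmixedOfRank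 𝔮' 2 → 𝔮' ∈ (Ideal.span {Q} ⊔ Ideal.span {P}).minimalPrimes → Ideal.span {Q} ⊔ Ideal.span {P} ⊔ Ideal.span {T} ≤ 𝔮' → 𝔮' < 𝔭 → δstar < ideg 𝔮' 2 → ⌊c₁ * Δ⌋₊ + 1 < ideg 𝔭 1 → ¬ (Module.finrank ℚ ↥(homogeneousSubmodule (Fin (3 + 1)) ℚ ⌊c₁ * Δ⌋₊) = Module.finrank ℚ ↥(homogeneousSubmodule (Fin (3 + 1)) ℚ ⌊c₁ * Δ⌋₊ ⊓ 𝔭.restrictScalars ℚ) + ideg 𝔭 1) → ∃ (K : Type) (_ : Field K) (_ : NumberField K) (β : Fin 3 → K) (σ : K →+* ℂ), (Module.finrank ℚ K : ℝ) ≤ (c * Δ) ^ 3 ∧ Height.logHeight (Fin.cons (1 : K) β : Fin (3 + 1) → K) ≤ c * Y * Δ ^ 2 ∧ ‖(fun j => σ (β j)) - ω‖ ≤ Real.exp (-((Δ * Height.logHeight (Fin.cons (1 : K) β : Fin (3 + 1) → K) + Y * Module.finrank ℚ K) / c))) : ∀ (ω : Fin 3 → ℂ) (c₁ : ℝ), 1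 ≤ c₁ → ∃ lam : ℝ, 1 ≤ lam ∧
    ∃ c : ℝ, c₁ ≤ c ∧ ∀ Δ Y : ℝ, c ≤ Δ → Δ ≤ Y →
    ∀ (Q : Rx 3) (a : ℕ) (P : Rx 3) (b : ℕ) (𝔮 : Ideal (Rx 3)) (T : Rx 3) (τ : ℕ)
      (𝔭 : Ideal (Rx 3)), CycleAP3Datum ω c₁ Δ (lam * Y) Q a P b 𝔮 T τ 𝔭 →
    ∃ (K : Type) (_ : Field K) (_ : NumberField K) (β : Fin 3 → K) (σ : K →+* ℂ),
      (Module.finrank ℚ K : ℝ) ≤ (c * Δ) ^ 3 ∧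
      Height.logHeight (Fin.cons (1 : K) β : Fin (3 + 1) → K) ≤ c * Y * Δ ^ 2 ∧
      ‖(fun j => σ (β j)) - ω‖ ≤
        Real.exp (-((Δ * Height.logHeight (Fin.cons (1 : K) β : Fin (3 + 1) → K) +
          Y * Module.finrank ℚ K) / c)) := by
  intro ω c₁ hc₁
  classical
  -- the good-transfer constant `c₁g = max c₁ 24` (level `⌊c₁g Δ⌋ ≥ 3(a + b + τ) − 2`)
  set c₁g : ℝ := max c₁ 24 with hc₁gdef
  have hc₁c₁g : c₁ ≤ c₁g := le_max_left _ _
  have h24 : (24 : ℝ) ≤ c₁g := le_max_right _ _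
  have hc₁g1 : 1 ≤ c₁g := hc₁.trans hc₁c₁g
  have hc₁0 : 0 < c₁ := by linarith
  -- the four branch transfers (the far branch first: it fixes the satellite threshold `δ⋆`)
  obtain ⟨δs, hδs1, lf, hlf1, cf, hcf, hfar⟩ := hfarStub ω c₁ hc₁
  obtain ⟨lg, hlg1, cg, hcg, hgood⟩ := pointDatum_of_clause 3 (by norm_num) stub_zeroDimDictionary
    (stub_sharpClosestPoint stub_orbitClusterBound stub_zeroDimDictionary) ω c₁g hc₁g1
  obtain ⟨ll, hll1, cl, hcl, hline⟩ := pointDatum_of_lineSatellite3_log orbitFloorLog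
    stub_satelliteHeightLine stub_containerRestart ω c₁ hc₁
  obtain ⟨lb, hlb1, cb, hcb, hbdd⟩ := pointDatum_of_boundedSatellite3 orbitFloorLog
    stub_satelliteHeight stub_containerRestart δs hδs1 ω c₁ hc₁
  have hcg1 : 1 ≤ cg := hc₁g1.trans hcg
  have hcl1 : 1 ≤ cl := hc₁.trans hcl
  have hcb1 : 1 ≤ cb := hc₁.trans hcb
  have hcf1 : 1 ≤ cf := hc₁.trans hcf
  have hlg0 : 0 < lg := by linarith
  have hll0 : 0 < ll := by linarith
  have hlb0 : 0 < lb := by linarith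
  have hlf0 : 0 < lf := by linarith
  -- per-branch co-boosts (the product of the other three boosts)
  obtain ⟨mg, hmg⟩ : ∃ mg : ℝ, mg = ll * lb * lf := ⟨_, rfl⟩
  obtain ⟨ml, hml⟩ : ∃ ml : ℝ, ml = lg * lb * lf := ⟨_, rfl⟩
  obtain ⟨mb, hmb⟩ : ∃ mb : ℝ, mb = lg * ll * lf := ⟨_, rfl⟩
  obtain ⟨mf, hmf⟩ : ∃ mf : ℝ, mf = lg * ll * lb := ⟨_, rfl⟩
  have hmg1 : 1 ≤ mg :=
    hmg ▸ one_le_mul_of_one_le_of_one_le (one_le_mul_of_one_le_of_one_le hll1 hlb1) hlf1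
  have hml1 : 1 ≤ ml :=
    hml ▸ one_le_mul_of_one_le_of_one_le (one_le_mul_of_one_le_of_one_le hlg1 hlb1) hlf1
  have hmb1 : 1 ≤ mb :=
    hmb ▸ one_le_mul_of_one_le_of_one_le (one_le_mul_of_one_le_of_one_le hlg1 hll1) hlf1
  have hmf1 : 1 ≤ mf :=
    hmf ▸ one_le_mul_of_one_le_of_one_le (one_le_mul_of_one_le_of_one_le hlg1 hll1) hlb1
  have hmg0 : 0 ≤ mg := by linarith
  have hml0 : 0 ≤ ml := by linarith
  have hmb0 : 0 ≤ mb := by linarith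
  have hmf0 : 0 ≤ mf := by linarith
  -- total boost and final constant
  refine ⟨lg * ll * lb * lf, one_le_mul_of_one_le_of_one_le
    (one_le_mul_of_one_le_of_one_le (one_le_mul_of_one_le_of_one_le hlg1 hll1) hlb1) hlf1, ?_⟩
  obtain ⟨C, hCdef⟩ : ∃ C : ℝ, C = cg * mg + cl * ml + cb * mb + cf * mf := ⟨_, rfl⟩
  have tg : 0 ≤ cg * mg := by positivity
  have tl : 0 ≤ cl * ml := by positivity
  have tb : 0 ≤ cb * mb := by positivity
  have tf : 0 ≤ cf * mf := by positivity
  have hCg : cg * mg ≤ C := by rw [hCdef]; linarith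
  have hCl : cl * ml ≤ C := by rw [hCdef]; linarith
  have hCb : cb * mb ≤ C := by rw [hCdef]; linarith
  have hCf : cf * mf ≤ C := by rw [hCdef]; linarith
  have hcgC : cg ≤ C := le_trans (le_mul_of_one_le_right (by linarith) hmg1) hCg
  have hclC : cl ≤ C := le_trans (le_mul_of_one_le_right (by linarith) hml1) hCl
  have hcbC : cb ≤ C := le_trans (le_mul_of_one_le_right (by linarith) hmb1) hCb
  have hcfC : cf ≤ C := le_trans (le_mul_of_one_le_right (by linarith) hmf1) hCf
  refine ⟨C, hc₁c₁g.trans (hcg.trans hcgC), ?_⟩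
  intro Δ Y hΔ hY Q a P b 𝔮 T τ 𝔭 hd
  have hC1 : 1 ≤ C := hcg1.trans hcgC
  have hΔ1 : 1 ≤ Δ := hC1.trans hΔ
  have hΔ0 : 0 ≤ Δ := by linarith
  have hY0 : 0 ≤ Y := by linarith
  have hcgΔ : cg ≤ Δ := hcgC.trans hΔ
  have hclΔ : cl ≤ Δ := hclC.trans hΔ
  have hcbΔ : cb ≤ Δ := hcbC.trans hΔ
  have hcfΔ : cf ≤ Δ := hcfC.trans hΔ
  -- the four per-branch scales `m_x · Y`
  have hYg : Y ≤ mg * Y := le_mul_of_one_le_left hY0 hmg1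
  have hYl : Y ≤ ml * Y := le_mul_of_one_le_left hY0 hml1
  have hYb : Y ≤ mb * Y := le_mul_of_one_le_left hY0 hmb1
  have hYf : Y ≤ mf * Y := le_mul_of_one_le_left hY0 hmf1
  have hΔYg : Δ ≤ mg * Y := hY.trans hYg
  have hΔYl : Δ ≤ ml * Y := hY.trans hYl
  have hΔYb : Δ ≤ mb * Y := hY.trans hYb
  have hΔYf : Δ ≤ mf * Y := hY.trans hYf
  have eg : lg * ll * lb * lf * Y = lg * (mg * Y) := by rw [hmg]; ring
  have el : lg * ll * lb * lf * Y = ll * (ml * Y) := by rw [hml]; ring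
  have eb : lg * ll * lb * lf * Y = lb * (mb * Y) := by rw [hmb]; ring
  have ef : lg * ll * lb * lf * Y = lf * (mf * Y) := by rw [hmf]; ring
  -- unpack the datum (keeping a folded copy for the far branch)
  have hdfull := hd
  obtain ⟨hQ0, hQa, ha1, haΔ, hQp, hPb, hb1, hbΔ, hPQ, h𝔮p, h𝔮h, h𝔮u, hQ𝔮, hP𝔮, -, -, -, hTτ, hτ1,
    hτΔ, hT𝔮, h𝔭p, h𝔭h, h𝔭u, h𝔮𝔭, hT𝔭, -, hdeg, hht, habs⟩ := hd
  have hspan : Ideal.span {Q} ⊔ Ideal.span {P} ⊔ Ideal.span {T} ≤ 𝔭 :=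
    sup_le (sup_le ((Ideal.span_singleton_le_iff_mem _).mpr (h𝔮𝔭 hQ𝔮))
      ((Ideal.span_singleton_le_iff_mem _).mpr (h𝔮𝔭 hP𝔮)))
      ((Ideal.span_singleton_le_iff_mem _).mpr hT𝔭)
  -- (G): the good transfer at constant `c₁g`, given the clause at level `⌊c₁g Δ⌋`
  have good : Module.finrank ℚ ↥(homogeneousSubmodule (Fin (3 + 1)) ℚ ⌊c₁g * Δ⌋₊) =
      Module.finrank ℚ ↥(homogeneousSubmodule (Fin (3 + 1)) ℚ ⌊c₁g * Δ⌋₊ ⊓ 𝔭.restrictScalars ℚ) +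
        ideg 𝔭 1 →
      ∃ (K : Type) (_ : Field K) (_ : NumberField K) (β : Fin 3 → K) (σ : K →+* ℂ),
        (Module.finrank ℚ K : ℝ) ≤ (C * Δ) ^ 3 ∧
        Height.logHeight (Fin.cons (1 : K) β : Fin (3 + 1) → K) ≤ C * Y * Δ ^ 2 ∧
        ‖(fun j => σ (β j)) - ω‖ ≤
          Real.exp (-((Δ * Height.logHeight (Fin.cons (1 : K) β : Fin (3 + 1) → K) +
            Y * Module.finrank ℚ K) / C)) := by
    intro hcl'
    have hY' : 0 ≤ lg * (mg * Y) := by positivity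
    obtain ⟨hdeg', hht', habs'⟩ := orbitBounds_mono (𝔭 := 𝔭) (ω := ω) hc₁ hc₁c₁g hΔ0 hY'
      hdeg (by rw [← eg]; exact hht) (by rw [← eg]; exact habs)
    have hdat := hgood Δ (mg * Y) hcgΔ hΔYg 𝔭 h𝔭p h𝔭h h𝔭u hdeg'
      (by simpa [mul_comm, mul_left_comm, mul_assoc] using hht')
      (by simpa [mul_comm, mul_left_comm, mul_assoc] using habs') hcl'
    exact datum_mono hcg1 hcgC hΔ0 hY0 hYg
      (by calc cg * (mg * Y) = cg * mg * Y := by ring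
          _ ≤ C * Y := mul_le_mul_of_nonneg_right hCg hY0) hdat
  by_cases hclause : Module.finrank ℚ ↥(homogeneousSubmodule (Fin (3 + 1)) ℚ ⌊c₁ * Δ⌋₊) =
      Module.finrank ℚ ↥(homogeneousSubmodule (Fin (3 + 1)) ℚ ⌊c₁ * Δ⌋₊ ⊓ 𝔭.restrictScalars ℚ) +
        ideg 𝔭 1
  · -- (G) the clause at `⌊c₁Δ⌋`, hence at `⌊c₁g Δ⌋`
    exact good (clause_mono_level 3 𝔭 h𝔭p h𝔭h h𝔭u _ _
      (Nat.floor_le_floor (mul_le_mul_of_nonneg_right hc₁c₁g hΔ0)) hclause)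
  · -- (¬G): the orbit is long
    have hlong : ⌊c₁ * Δ⌋₊ + 1 < ideg 𝔭 1 := by
      by_contra hsh
      exact hclause (rankOne_interpolation_of_ideg_le 3 𝔭 _ h𝔭p h𝔭h h𝔭u (not_lt.mp hsh))
    rcases satellite_dichotomy Q P T a b τ hQ0 hQa hPb hTτ ha1 hb1 hτ1 hQp hPQ 𝔭 h𝔭p h𝔭h h𝔭u hspan
      with hmin | ⟨𝔮', h𝔮'p, h𝔮'h, h𝔮'u, h𝔮'min, h𝔮'le, h𝔮'lt⟩
    · -- (I) isolated point of the triple intersection: Chardin–Philippon at level `⌊c₁g Δ⌋`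
      refine good (hCP Q P T a b τ (a + b + τ) hQa hPb hTτ ha1 hb1 hτ1
        (by omega) (by omega) (by omega) 𝔭 h𝔭p h𝔭h h𝔭u hmin _ ?_)
      -- `3 (a + b + τ) ≤ ⌊c₁g Δ⌋ + 2` from `a + b + τ ≤ 8Δ` and `c₁g ≥ 24`
      have h8 : (a : ℝ) + b + τ ≤ 8 * Δ := by linarith only [haΔ, hbΔ, hτΔ]
      have hfl : (3 : ℝ) * (8 * Δ) ≤ (⌊c₁g * Δ⌋₊ : ℝ) + 2 := by
        have h1 : c₁g * Δ - 1 < ⌊c₁g * Δ⌋₊ := Nat.sub_one_lt_floor (c₁g * Δ)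
        have h2 : 24 * Δ ≤ c₁g * Δ := mul_le_mul_of_nonneg_right h24 hΔ0
        linarith only [h1, h2]
      have : ((3 * (a + b + τ) : ℕ) : ℝ) ≤ ((⌊c₁g * Δ⌋₊ + 2 : ℕ) : ℝ) := by
        push_cast; linarith only [h8, hfl]
      exact_mod_cast this
    · -- a satellite `𝔮'`: `Q, P ∈ 𝔮'`, `𝔮' ≤ 𝔭`
      have hQ𝔮' : Q ∈ 𝔮' := h𝔮'le (Ideal.mem_sup_left (Ideal.mem_sup_left (Ideal.mem_span_singleton_self Q)))
      have hP𝔮' : P ∈ 𝔮' := h𝔮'le (Ideal.mem_sup_left (Ideal.mem_sup_right (Ideal.mem_span_singleton_self P)))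
      have hab : (a : ℝ) + b ≤ 3 * Δ := by linarith only [haΔ, hbΔ]
      by_cases hlineCase : ideg 𝔮' 2 = 1
      · -- (L) line satellite: log floor + restart, at the scale `(Δ, ml Y)`
        have hdat := hline Δ (ml * Y) hclΔ hΔYl Q a P b 𝔮' 𝔭 hQ0 hQa hPb ha1 hb1 hab hQp hPQ
          h𝔮'p h𝔮'h h𝔮'u hQ𝔮' hP𝔮' hlineCase h𝔭p h𝔭h h𝔭u h𝔮'lt.le hlong hdeg
          (by rw [← el]; exact hht) (by rw [← el]; exact habs)
        exact datum_mono hcl1 hclC hΔ0 hY0 hYl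
          (by calc cl * (ml * Y) = cl * ml * Y := by ring
              _ ≤ C * Y := mul_le_mul_of_nonneg_right hCl hY0) hdat
      · by_cases hbddCase : ideg 𝔮' 2 ≤ δs
        · -- (B) bounded-degree satellite: log floor + satellite height + restart, scale `(Δ, mb Y)`
          have hdat := hbdd Δ (mb * Y) hcbΔ hΔYb Q a P b 𝔮' 𝔭 hQ0 hQa hPb ha1 hb1 hab hQp hPQ
            h𝔮'p h𝔮'h h𝔮'u hQ𝔮' hP𝔮' hbddCase h𝔭p h𝔭h h𝔭u h𝔮'lt.le hlong hdeg
            (by rw [← eb]; exact hht) (by rw [← eb]; exact habs)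
          exact datum_mono hcb1 hcbC hΔ0 hY0 hYb
            (by calc cb * (mb * Y) = cb * mb * Y := by ring
                _ ≤ C * Y := mul_le_mul_of_nonneg_right hCb hY0) hdat
        · -- (F) far satellite (degree `> δ⋆`): the open kernel, at the scale `(Δ, mf Y)`
          have hfarCase : δs < ideg 𝔮' 2 := not_le.mp hbddCase
          have hd' : CycleAP3Datum ω c₁ Δ (lf * (mf * Y)) Q a P b 𝔮 T τ 𝔭 := by
            rw [← ef]; exact hdfull
          have hdat := hfar Δ (mf * Y) hcfΔ hΔYf Q a P b 𝔮 T τ 𝔭 𝔮' hd' h𝔮'p h𝔮'h h𝔮'u h𝔮'min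
            h𝔮'le h𝔮'lt hfarCase hlong hclause
          exact datum_mono hcf1 hcfC hΔ0 hY0 hYf
            (by calc cf * (mf * Y) = cf * mf * Y := by ring
                _ ≤ C * Y := mul_le_mul_of_nonneg_right hCf hY0) hdat


open PointAPThreeConditional in
/-- **`PointAPAbsAt 3` conditionally**: Philippon's AP2 for `n = 3` with pointwise constants, from the
landed clause-free descent with its data (`stub_cycleAP3Data`) and `pointDatum_of_datum3_of`, under the
two `t = 3` hypotheses. [cite: NesterenkoPhilippon2001, Ch. 4 §4 p. 61] -/
theorem pointAPAt3_of (hCP : IsolatedPointClause3)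
    (hfarStub : ∀ (ω : Fin 3 → ℂ) (c₁ : ℝ), 1 ≤ c₁ → ∃ δstar : ℕ, 1 ≤ δstar ∧ ∃ lam : ℝ, 1 ≤ lam ∧ ∃ c : ℝ, c₁ ≤ c ∧ ∀ Δ Y : ℝ, c ≤ Δ → Δ ≤ Y → ∀ (Q : Rx 3) (a : ℕ) (P : Rx 3) (b : ℕ) (𝔮 : Ideal (Rx 3)) (T : Rx 3) (τ : ℕ) (𝔭 𝔮' : Ideal (Rx 3)), CycleAP3Datum ω c₁ Δ (lam * Y) Q a P b 𝔮 T τ 𝔭 → 𝔮'.IsPrime → 𝔮'.IsHomogeneous (homogeneousSubmodule (Fin (3 + 1)) ℚ) → IsUnmixedOfRank 𝔮' 2 → 𝔮' ∈ (Ideal.span {Q} ⊔ Ideal.span {P}).minimalPrimes → Ideal.span {Q} ⊔ Ideal.span {P} ⊔ Ideal.span {T} ≤ 𝔮' → 𝔮' < 𝔭 → δstar < ideg 𝔮' 2 → ⌊c₁ * Δ⌋₊ + 1 < ideg 𝔭 1 → ¬ (Module.finrank ℚ ↥(homogeneousSubmodule (Fin (3 + 1)) ℚ ⌊c₁ * Δ⌋₊)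 = Module.finrank ℚ ↥(homogeneousSubmodule (Fin (3 + 1)) ℚ ⌊c₁ * Δ⌋₊ ⊓ 𝔭.restrictScalars ℚ) + ideg 𝔭 1) → ∃ (K : Type) (_ : Field K) (_ : NumberField K) (β : Fin 3 → K) (σ : K →+* ℂ), (Module.finrank ℚ K : ℝ) ≤ (c * Δ) ^ 3 ∧ Height.logHeight (Fin.cons (1 : K) β : Fin (3 + 1) → K) ≤ c * Y * Δ ^ 2 ∧ ‖(fun j => σ (β j)) - ω‖ ≤ Real.exp (-((Δ * Height.logHeight (Fin.cons (1 : K) β : Fin (3 + 1) → K) + Y * Module.finrank ℚ K) / c))) :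
    PointAPAbsAt 3 := by
  intro ω
  classical
  obtain ⟨c₀, hc₀1, hdata⟩ := stub_cycleAP3Data ω
  obtain ⟨lam, hlam1, c, hc, htrans⟩ := pointDatum_of_datum3_of hCP hfarStub ω c₀ hc₀1
  have hc1 : 1 ≤ c := hc₀1.trans hc
  refine ⟨c, hc1, fun Δ Y hΔ hY => ?_⟩
  have hY0 : 0 ≤ Y := by linarith [hc1.trans hΔ]
  have hΔY' : Δ ≤ lam * Y := hY.trans (le_mul_of_one_le_left hY0 hlam1)
  obtain ⟨Q, a, P, b, 𝔮, T, τ, 𝔭, hd⟩ := hdata Δ (lam * Y) (hc.trans hΔ) hΔY'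
  exact htrans Δ Y hΔ hY Q a P b 𝔮 T τ 𝔭 hd

/-- The point property in dimensions `1` and `2` from the landed cycle inputs, dictionary, lever and
transfer. -/
theorem PointAPThreeConditional.pointAP_le_two : ∀ t : ℕ, 1 ≤ t → t ≤ 2 → PointAPAbsAt t :=
  fun t h₁ h₂ =>
  stub_pointAP t h₁ stub_zeroDimDictionary
    (if e₁ : t = 1 then e₁ ▸ stub_cycleAPI_one
      else (show t = 2 by omega) ▸ cycleAPIAt_two)
    (stub_sharpClosestPoint stub_orbitClusterBound stub_zeroDimDictionary)

/-- **The `t = 3` slice of the crux, conditionally (registered sub-goal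
`slice_three_of_isolatedClause_of_farBeyond`)**: the approximation property for EVERY `θ ∈ ℂ^ι` with
`trdeg_ℚ ℚ(θ) ≤ 3`, all scales, output-dependent accuracy — NOT in print (LNM 1752 Ch. 4 §4 p. 61 proves
AP2 for `n ≤ 2` only) — from Chardin–Philippon's dimension-`0` regularity (`IsolatedPointClause3`) and
the far-satellite datum beyond a threshold (the one open statement), via `pointAPAt3_of`, the landed
`t ≤ 2` point properties and the landed lifting `stub_lift`. [cite: NesterenkoPhilippon2001, Ch. 4 §4
p. 61; LaurentRoy1999, Thm 1] -/
theorem slice_three_of_isolatedClause_of_farBeyond : IsolatedPointClause3 → (∀ (ω : Fin 3 → ℂ) (c₁ : ℝ), 1 ≤ c₁ → ∃ δstar : ℕ, 1 ≤ δstar ∧ ∃ lam : ℝ, 1 ≤ lam ∧ ∃ c : ℝ, c₁ ≤ c ∧ ∀ Δ Y : ℝ, c ≤ Δ → Δ ≤ Y → ∀ (Q : Rx 3) (a : ℕ) (P : Rx 3) (b : ℕ) (𝔮 : Ideal (Rx 3)) (T : Rx 3) (τ : ℕ) (𝔭 𝔮' : Ideal (Rx 3)), CycleAP3Datum ω c₁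 Δ (lam * Y) Q a P b 𝔮 T τ 𝔭 → 𝔮'.IsPrime → 𝔮'.IsHomogeneous (homogeneousSubmodule (Fin (3 + 1)) ℚ) → IsUnmixedOfRank 𝔮' 2 → 𝔮' ∈ (Ideal.span {Q} ⊔ Ideal.span {P}).minimalPrimes → Ideal.span {Q} ⊔ Ideal.span {P} ⊔ Ideal.span {T} ≤ 𝔮' → 𝔮' < 𝔭 → δstar < ideg 𝔮' 2 → ⌊c₁ * Δ⌋₊ + 1 < ideg 𝔭 1 → ¬ (Module.finrank ℚ ↥(homogeneousSubmodule (Fin (3 + 1)) ℚ ⌊c₁ * Δ⌋₊) = Module.finrank ℚ ↥(homogeneousSubmodule (Fin (3 + 1)) ℚ ⌊c₁ * Δ⌋₊ ⊓ 𝔭.restrictScalars ℚ) + ideg 𝔭 1) → ∃ (K : Type) (_ : Field K) (_ : NumberField K) (β : Fin 3 → K) (σ : K →+* ℂ), (Module.finrank ℚ K : ℝ) ≤ (c * Δ) ^ 3 ∧ Height.logHeight (Fin.cons (1 : K) β : Fin (3 + 1) → K) ≤ c * Y * Δ ^ 2 ∧ ‖(fun j => σ (β j)) - ω‖ ≤ Real.exp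 (-((Δ * Height.logHeight (Fin.cons (1 : K) β : Fin (3 + 1) → K) + Y * Module.finrank ℚ K) / c))) → PointwiseAPSlice 3 := by
  intro hCP hfarStub
  exact stub_lift 3 (by norm_num) fun t₀ h₀ h₀3 =>
    if h₂ : t₀ ≤ 2 then PointAPThreeConditional.pointAP_le_two t₀ h₀ h₂
    else (show t₀ = 3 by omega) ▸ pointAPAt3_of hCP hfarStub

end

end Summit.Schanuel.Schanuel.Cruxes.ApproximationProperty.OrbitInterpolationDeterminant
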